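import Summits.Ventures.PercRepro.C041BlockMapParallel
import Summits.Ventures.PercRepro.C041BlockMapPath

/-!
# ROW C-041 — THEOREM (BUNDLE): the block map of a host with an edge replaced by a bundle of `m + 1` parallel
copies is the block map of the host plus `2ᵐ − 1` times the block map of the host with that edge contracted
(p6, gen 35; the parallel twin of THEOREM (PATH), THEOREM (PARALLEL EDGE) of `C041BlockMapParallel` being the
case `m = 1`)

Setting of `C041BlockMapParallel` (the contraction `contract Z₁ x y` by the redirection `redC x y`) and
`C041BlockMapPathHost` (the agreement predicate `pathAgree e₀ m ω'`: the `m` new edges `inr i` all carry the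
colour of `inl e₀`).  The BUNDLE host `bundle Z₁ e₀ m` (edges `E₁ ⊕ Fin m`, the same vertices) has the `m`
extra copies `inr i` of `e₀`, each joining `fst e₀` to `snd e₀`.  A colouring of the bundle host that agrees
changes nothing (`reflTransGen_bundle_iff_agree`: a step along a copy is a step along `e₀` of the same colour);
a colouring that disagrees carries both colours on the bundle, so the ends of `e₀` are adjacent in either colour
(`cAdj_bundle_ends_of_disagree`) — exactly the contraction (`reflTransGen_bundle_iff_disagree`, through
`reflTransGen_bundle_of_redC_eq`: vertices with the same redirection are connected in either colour).  Hence the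
merged set, the blocks and the colouring term of a bundle colouring are those of `Z₁` or of the contracted host
(exits and anchor redirected) under the restricted colouring `ω' ∘ inl`; the colourings of the bundle host are
the pairs (colouring of `Z₁`, colouring of the `m` copies), and of the `2ᵐ` colourings of the copies exactly one
agrees with the colour of `e₀` (`sum_colTerm_bundle_elim`): **`blockMap_bundle`:
`blockMap (bundle Z₁ e₀ m) u a₁ w = blockMap Z₁ u a₁ w + (2ᵐ − 1) • blockMap (contract Z₁ x y) (redC x y ∘ u)
(redC x y a₁) w`**, i.e. `Θ_{Z₁ with e₀ made a bundle of m + 1 edges} = Θ_{Z₁} + (2ᵐ − 1)·Θ_{Z₁ / e₀}`.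
COROLLARY (`inCone_blockMap_bundle`): the cone conjecture for block maps is closed under replacing an edge by a
bundle of any multiplicity — every bundle of parallel edges collapses in ONE step.
-/

namespace PercRepro

namespace ZoneZ

namespace MultiExit

open ZoneData Pendant Finset TwoExit TreeClosure

variable {V₁ E₁ U₁ U₂ : Type} (Z₁ : ZoneData V₁ E₁ U₁ U₂) (e₀ : E₁) (m : ℕ)

/-! ## The bundle host -/

/-- The host with the `m` extra copies `inr i` of the edge `e₀`, each joining `fst e₀` to `snd e₀`. -/
def bundle : ZoneData V₁ (E₁ ⊕ Fin m) U₁ U₂ where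
  fst := fun e => match e with
    | Sum.inl e => Z₁.fst e
    | Sum.inr _ => Z₁.fst e₀
  snd := fun e => match e with
    | Sum.inl e => Z₁.snd e
    | Sum.inr _ => Z₁.snd e₀
  at₁ := Z₁.at₁
  at₂ := Z₁.at₂

/-- `Joins` of an old edge in the bundle host. -/
theorem bundle_joins_inl (e : E₁) (v v' : V₁) : (bundle Z₁ e₀ m).Joins (Sum.inl e) v v' ↔ Z₁.Joins e v v' :=
  Iff.rfl

/-- `Joins` of a copy: the ends of `e₀`. -/
theorem bundle_joins_inr (i : Fin m) (v v' : V₁) :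
    (bundle Z₁ e₀ m).Joins (Sum.inr i) v v' ↔ Z₁.Joins e₀ v v' :=
  Iff.rfl

/-! ## The reach in the bundle host -/

section Reach

variable (c : Bool) (ω' : E₁ ⊕ Fin m → Bool)

/-- The colouring AGREES: paths of the bundle host are paths of `Z₁`. -/
theorem reflTransGen_bundle_iff_agree (h : pathAgree e₀ m ω') (v v' : V₁) :
    Relation.ReflTransGen (cAdj (bundle Z₁ e₀ m) c ω') v v' ↔
      Relation.ReflTransGen (cAdj Z₁ c fun e => ω' (Sum.inl e)) v v' := by
  constructor
  · intro hp
    induction hp with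
    | refl => exact Relation.ReflTransGen.refl
    | tail _ hstep ih =>
      obtain ⟨e, hj, hc⟩ := hstep
      rcases e with e | i
      · exact ih.tail ⟨e, (bundle_joins_inl Z₁ e₀ m e _ _).1 hj, hc⟩
      · exact ih.tail ⟨e₀, (bundle_joins_inr Z₁ e₀ m i _ _).1 hj, (h i).symm.trans hc⟩
  · intro hp
    induction hp with
    | refl => exact Relation.ReflTransGen.refl
    | tail _ hstep ih =>
      obtain ⟨e, hj, hc⟩ := hstep
      exact ih.tail ⟨Sum.inl e, (bundle_joins_inl Z₁ e₀ m e _ _).2 hj, hc⟩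

/-- The colouring DISAGREES: the bundle carries both colours, so the ends of `e₀` are adjacent in either
colour. -/
theorem cAdj_bundle_ends_of_disagree (h : ¬ pathAgree e₀ m ω') :
    cAdj (bundle Z₁ e₀ m) c ω' (Z₁.fst e₀) (Z₁.snd e₀) := by
  by_cases hc : ω' (Sum.inl e₀) = c
  · exact ⟨Sum.inl e₀, (bundle_joins_inl Z₁ e₀ m e₀ _ _).2 (Or.inl ⟨rfl, rfl⟩), hc⟩
  · obtain ⟨i, hi⟩ := not_forall.1 h
    have h1 : ω' (Sum.inl e₀) = !c := Bool.eq_not_iff.2 hc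
    have h2 : ω' (Sum.inr i) = !(ω' (Sum.inl e₀)) := Bool.eq_not_iff.2 hi
    refine ⟨Sum.inr i, (bundle_joins_inr Z₁ e₀ m i _ _).2 (Or.inl ⟨rfl, rfl⟩), ?_⟩
    rw [h2, h1, Bool.not_not]

variable [DecidableEq V₁]

/-- The colouring disagrees: vertices with the same redirection are connected in either colour. -/
theorem reflTransGen_bundle_of_redC_eq (h : ¬ pathAgree e₀ m ω') {v v' : V₁}
    (hvv : redC (Z₁.fst e₀) (Z₁.snd e₀) v = redC (Z₁.fst e₀) (Z₁.snd e₀) v') :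
    Relation.ReflTransGen (cAdj (bundle Z₁ e₀ m) c ω') v v' := by
  have hxy := cAdj_bundle_ends_of_disagree Z₁ e₀ m c ω' h
  have hyx := cAdj_symm _ c ω' _ _ hxy
  rcases (redC_eq_redC_iff _ _ v v').1 hvv with rfl | ⟨hv | hv, hv' | hv'⟩
  · exact Relation.ReflTransGen.refl
  · rw [hv, hv']
  · rw [hv, hv']
    exact Relation.ReflTransGen.single hxy
  · rw [hv, hv']
    exact Relation.ReflTransGen.single hyx
  · rw [hv, hv']

/-- The colouring DISAGREES: paths of the bundle host are paths of the contracted host between the redirected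
ends. -/
theorem reflTransGen_bundle_iff_disagree (h : ¬ pathAgree e₀ m ω') (v v' : V₁) :
    Relation.ReflTransGen (cAdj (bundle Z₁ e₀ m) c ω') v v' ↔
      Relation.ReflTransGen (cAdj (contract Z₁ (Z₁.fst e₀) (Z₁.snd e₀)) c fun e => ω' (Sum.inl e))
        (redC (Z₁.fst e₀) (Z₁.snd e₀) v) (redC (Z₁.fst e₀) (Z₁.snd e₀) v') := by
  constructor
  · intro hp
    induction hp with
    | refl => exact Relation.ReflTransGen.refl
    | tail _ hstep ih =>
      obtain ⟨e, hj, hc⟩ := hstep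
      rcases e with e | i
      · rw [bundle_joins_inl] at hj
        exact ih.tail ⟨e, (contract_joins Z₁ _ _ e _ _).2 ⟨_, _, rfl, rfl, hj⟩, hc⟩
      · rw [bundle_joins_inr] at hj
        rw [← redC_eq_of_joins_self Z₁ e₀ hj]
        exact ih
  · intro hp
    -- every vertex with the redirection of the target is reached
    have key : ∀ z, Relation.ReflTransGen (cAdj (contract Z₁ (Z₁.fst e₀) (Z₁.snd e₀)) c fun e => ω' (Sum.inl e))
        (redC (Z₁.fst e₀) (Z₁.snd e₀) v) z →
        ∀ v'', redC (Z₁.fst e₀) (Z₁.snd e₀) v'' = z →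
          Relation.ReflTransGen (cAdj (bundle Z₁ e₀ m) c ω') v v'' := by
      intro z hz
      induction hz with
      | refl =>
        intro v'' hv''
        exact reflTransGen_bundle_of_redC_eq Z₁ e₀ m c ω' h hv''.symm
      | tail _ hstep ih =>
        intro v'' hv''
        obtain ⟨e, hj, hc⟩ := hstep
        rw [contract_joins] at hj
        obtain ⟨v₁, v₂, hz, hz', hvv⟩ := hj
        exact ((ih v₁ hz.symm).tail ⟨Sum.inl e, (bundle_joins_inl Z₁ e₀ m e _ _).2 hvv, hc⟩).trans
          (reflTransGen_bundle_of_redC_eq Z₁ e₀ m c ω' h (hz'.symm.trans hv''.symm))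
    exact key _ hp v' rfl

end Reach

/-! ## The statuses, the sets and the colouring terms -/

section Statuses

variable (ω' : E₁ ⊕ Fin m → Bool)

/-- Merged status, colouring agreeing. -/
theorem Mg_bundle_agree (h : pathAgree e₀ m ω') (v v' : V₁) :
    (bundle Z₁ e₀ m).Mg v v' ω' ↔ Z₁.Mg v v' fun e => ω' (Sum.inl e) := by
  rw [Mg_iff_reflTransGen, Mg_iff_reflTransGen]
  exact reflTransGen_bundle_iff_agree Z₁ e₀ m false ω' h v v'

/-- Reached status, colouring agreeing. -/
theorem Rd_bundle_agree (h : pathAgree e₀ m ω') (v v' : V₁) :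
    (bundle Z₁ e₀ m).Rd v v' ω' ↔ Z₁.Rd v v' fun e => ω' (Sum.inl e) := by
  rw [Rd_iff_reflTransGen, Rd_iff_reflTransGen]
  exact reflTransGen_bundle_iff_agree Z₁ e₀ m true ω' h v v'

variable [DecidableEq V₁]

/-- Merged status, colouring disagreeing. -/
theorem Mg_bundle_disagree (h : ¬ pathAgree e₀ m ω') (v v' : V₁) :
    (bundle Z₁ e₀ m).Mg v v' ω' ↔ (contract Z₁ (Z₁.fst e₀) (Z₁.snd e₀)).Mg (redC (Z₁.fst e₀) (Z₁.snd e₀) v)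
      (redC (Z₁.fst e₀) (Z₁.snd e₀) v') fun e => ω' (Sum.inl e) := by
  rw [Mg_iff_reflTransGen, Mg_iff_reflTransGen]
  exact reflTransGen_bundle_iff_disagree Z₁ e₀ m false ω' h v v'

/-- Reached status, colouring disagreeing. -/
theorem Rd_bundle_disagree (h : ¬ pathAgree e₀ m ω') (v v' : V₁) :
    (bundle Z₁ e₀ m).Rd v v' ω' ↔ (contract Z₁ (Z₁.fst e₀) (Z₁.snd e₀)).Rd (redC (Z₁.fst e₀) (Z₁.snd e₀) v)
      (redC (Z₁.fst e₀) (Z₁.snd e₀) v') fun e => ω' (Sum.inl e) := by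
  rw [Rd_iff_reflTransGen, Rd_iff_reflTransGen]
  exact reflTransGen_bundle_iff_disagree Z₁ e₀ m true ω' h v v'

variable {ι : Type} (u : ι → V₁) (a₁ : V₁) [Fintype ι]

omit [DecidableEq V₁] in
/-- The merged set, colouring agreeing. -/
theorem merged_bundle_agree (h : pathAgree e₀ m ω') :
    merged (bundle Z₁ e₀ m) u a₁ ω' = merged Z₁ u a₁ fun e => ω' (Sum.inl e) := by
  ext k
  rw [mem_merged, mem_merged, Mg_bundle_agree Z₁ e₀ m ω' h]

omit [DecidableEq V₁] in
/-- The blocks, colouring agreeing. -/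
theorem blk_bundle_agree (h : pathAgree e₀ m ω') :
    blk (bundle Z₁ e₀ m) u a₁ ω' = blk Z₁ u a₁ fun e => ω' (Sum.inl e) := by
  funext k
  ext l
  rw [mem_blk, mem_blk, Mg_bundle_agree Z₁ e₀ m ω' h, Mg_bundle_agree Z₁ e₀ m ω' h]

omit [DecidableEq V₁] in
/-- The blocks, colouring agreeing. -/
theorem blocks_bundle_agree (h : pathAgree e₀ m ω') :
    blocks (bundle Z₁ e₀ m) u a₁ ω' = blocks Z₁ u a₁ fun e => ω' (Sum.inl e) := by
  ext B
  rw [mem_blocks, mem_blocks]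
  simp only [Mg_bundle_agree Z₁ e₀ m ω' h, blk_bundle_agree Z₁ e₀ m ω' u a₁ h]

/-- The merged set, colouring disagreeing: that of the contracted host at the redirected exits. -/
theorem merged_bundle_disagree (h : ¬ pathAgree e₀ m ω') :
    merged (bundle Z₁ e₀ m) u a₁ ω' = merged (contract Z₁ (Z₁.fst e₀) (Z₁.snd e₀))
      (fun k => redC (Z₁.fst e₀) (Z₁.snd e₀) (u k)) (redC (Z₁.fst e₀) (Z₁.snd e₀) a₁)
      fun e => ω' (Sum.inl e) := by
  ext k
  rw [mem_merged, mem_merged, Mg_bundle_disagree Z₁ e₀ m ω' h]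

/-- The blocks, colouring disagreeing. -/
theorem blk_bundle_disagree (h : ¬ pathAgree e₀ m ω') :
    blk (bundle Z₁ e₀ m) u a₁ ω' = blk (contract Z₁ (Z₁.fst e₀) (Z₁.snd e₀))
      (fun k => redC (Z₁.fst e₀) (Z₁.snd e₀) (u k)) (redC (Z₁.fst e₀) (Z₁.snd e₀) a₁)
      fun e => ω' (Sum.inl e) := by
  funext k
  ext l
  rw [mem_blk, mem_blk, Mg_bundle_disagree Z₁ e₀ m ω' h, Mg_bundle_disagree Z₁ e₀ m ω' h]

/-- The blocks, colouring disagreeing. -/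
theorem blocks_bundle_disagree (h : ¬ pathAgree e₀ m ω') :
    blocks (bundle Z₁ e₀ m) u a₁ ω' = blocks (contract Z₁ (Z₁.fst e₀) (Z₁.snd e₀))
      (fun k => redC (Z₁.fst e₀) (Z₁.snd e₀) (u k)) (redC (Z₁.fst e₀) (Z₁.snd e₀) a₁)
      fun e => ω' (Sum.inl e) := by
  ext B
  rw [mem_blocks, mem_blocks]
  simp only [Mg_bundle_disagree Z₁ e₀ m ω' h, blk_bundle_disagree Z₁ e₀ m ω' u a₁ h]

omit [DecidableEq V₁] in
/-- The colouring term, colouring agreeing. -/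
theorem colTerm_bundle_agree (h : pathAgree e₀ m ω') (w : ι → Vec6) :
    colTerm (bundle Z₁ e₀ m) u a₁ ω' w = colTerm Z₁ u a₁ (fun e => ω' (Sum.inl e)) w := by
  unfold colTerm
  rw [merged_bundle_agree Z₁ e₀ m ω' u a₁ h, blocks_bundle_agree Z₁ e₀ m ω' u a₁ h]
  simp only [Rd_bundle_agree Z₁ e₀ m ω' h]

/-- The colouring term, colouring disagreeing: that of the contracted host. -/
theorem colTerm_bundle_disagree (h : ¬ pathAgree e₀ m ω') (w : ι → Vec6) :
    colTerm (bundle Z₁ e₀ m) u a₁ ω' w = colTerm (contract Z₁ (Z₁.fst e₀) (Z₁.snd e₀))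
      (fun k => redC (Z₁.fst e₀) (Z₁.snd e₀) (u k)) (redC (Z₁.fst e₀) (Z₁.snd e₀) a₁)
      (fun e => ω' (Sum.inl e)) w := by
  unfold colTerm
  rw [merged_bundle_disagree Z₁ e₀ m ω' u a₁ h, blocks_bundle_disagree Z₁ e₀ m ω' u a₁ h]
  simp only [Rd_bundle_disagree Z₁ e₀ m ω' h]

end Statuses

/-! ## THEOREM (BUNDLE) -/

section Main

variable [DecidableEq V₁] {ι : Type} (u : ι → V₁) (a₁ : V₁) [Fintype ι]

/-- The colouring term of the bundle host at a glued colouring: the term of `Z₁` if the copies all carry the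
colour of `e₀`, the term of the contracted host otherwise. -/
theorem colTerm_bundle_elim (ω : E₁ → Bool) (τ : Fin m → Bool) (w : ι → Vec6) :
    colTerm (bundle Z₁ e₀ m) u a₁ (Sum.elim ω τ) w =
      if τ = fun _ => ω e₀ then colTerm Z₁ u a₁ ω w
      else colTerm (contract Z₁ (Z₁.fst e₀) (Z₁.snd e₀)) (fun k => redC (Z₁.fst e₀) (Z₁.snd e₀) (u k))
        (redC (Z₁.fst e₀) (Z₁.snd e₀) a₁) ω w := by
  by_cases hτ : τ = fun _ => ω e₀
  · rw [if_pos hτ, colTerm_bundle_agree Z₁ e₀ m _ u a₁ ((pathAgree_elim_iff e₀ m ω τ).2 hτ) w]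
    rfl
  · rw [if_neg hτ,
      colTerm_bundle_disagree Z₁ e₀ m _ u a₁ (fun h => hτ ((pathAgree_elim_iff e₀ m ω τ).1 h)) w]
    rfl

/-- Summing the colouring terms over the colourings of the `m` copies: exactly one of the `2ᵐ` colourings agrees
with the colour of `e₀`. -/
theorem sum_colTerm_bundle_elim (ω : E₁ → Bool) (w : ι → Vec6) :
    ∑ τ : Fin m → Bool, colTerm (bundle Z₁ e₀ m) u a₁ (Sum.elim ω τ) w =
      colTerm Z₁ u a₁ ω w + ((2 : ℝ) ^ m - 1) • colTerm (contract Z₁ (Z₁.fst e₀) (Z₁.snd e₀))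
        (fun k => redC (Z₁.fst e₀) (Z₁.snd e₀) (u k)) (redC (Z₁.fst e₀) (Z₁.snd e₀) a₁) ω w := by
  have hterm : ∀ τ : Fin m → Bool, colTerm (bundle Z₁ e₀ m) u a₁ (Sum.elim ω τ) w =
      colTerm (contract Z₁ (Z₁.fst e₀) (Z₁.snd e₀)) (fun k => redC (Z₁.fst e₀) (Z₁.snd e₀) (u k))
        (redC (Z₁.fst e₀) (Z₁.snd e₀) a₁) ω w +
        if τ = fun _ => ω e₀ then colTerm Z₁ u a₁ ω w - colTerm (contract Z₁ (Z₁.fst e₀) (Z₁.snd e₀))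
          (fun k => redC (Z₁.fst e₀) (Z₁.snd e₀) (u k)) (redC (Z₁.fst e₀) (Z₁.snd e₀) a₁) ω w else 0 := by
    intro τ
    rw [colTerm_bundle_elim Z₁ e₀ m u a₁ ω τ w]
    split_ifs <;> abel
  rw [Finset.sum_congr rfl fun τ _ => hterm τ, Finset.sum_add_distrib, Finset.sum_const, Finset.sum_ite_eq',
    if_pos (Finset.mem_univ _), Finset.card_univ, Fintype.card_fun, Fintype.card_bool, Fintype.card_fin]
  funext i
  simp only [Pi.add_apply, Pi.sub_apply, Pi.smul_apply]
  simp only [smul_eq_mul, nsmul_eq_mul, Nat.cast_pow, Nat.cast_ofNat]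
  ring

variable [Fintype E₁] [DecidableEq E₁]

/-- **THEOREM (BUNDLE)**: the block map of the host with `e₀` replaced by a bundle of `m + 1` parallel copies is
the block map of the host plus `2ᵐ − 1` times the block map of the host with `e₀` contracted (exits and anchor
redirected). -/
theorem blockMap_bundle (w : ι → Vec6) :
    blockMap (bundle Z₁ e₀ m) u a₁ w = blockMap Z₁ u a₁ w + ((2 : ℝ) ^ m - 1) •
      blockMap (contract Z₁ (Z₁.fst e₀) (Z₁.snd e₀)) (fun k => redC (Z₁.fst e₀) (Z₁.snd e₀) (u k))
        (redC (Z₁.fst e₀) (Z₁.snd e₀) a₁) w := by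
  rw [blockMap_eq_sum_colTerm, blockMap_eq_sum_colTerm, blockMap_eq_sum_colTerm, Finset.smul_sum,
    ← Finset.sum_add_distrib,
    ← Fintype.sum_equiv (Equiv.sumArrowEquivProdArrow E₁ (Fin m) Bool).symm
      (fun p => colTerm (bundle Z₁ e₀ m) u a₁ ((Equiv.sumArrowEquivProdArrow E₁ (Fin m) Bool).symm p) w) _
      (fun _ => rfl),
    Fintype.sum_prod_type]
  exact Finset.sum_congr rfl fun ω _ => sum_colTerm_bundle_elim Z₁ e₀ m u a₁ ω w

/-- **The cone conjecture for block maps is closed under replacing an edge by a bundle of parallel copies**: if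
the block maps of the host and of the contracted host send the family into the cone, so does the block map of the
bundle host. -/
theorem inCone_blockMap_bundle (w : ι → Vec6) (h₁ : InCone (blockMap Z₁ u a₁ w))
    (h₂ : InCone (blockMap (contract Z₁ (Z₁.fst e₀) (Z₁.snd e₀))
      (fun k => redC (Z₁.fst e₀) (Z₁.snd e₀) (u k)) (redC (Z₁.fst e₀) (Z₁.snd e₀) a₁) w)) :
    InCone (blockMap (bundle Z₁ e₀ m) u a₁ w) := by
  rw [blockMap_bundle]
  exact h₁.add (h₂.smul _ (two_pow_sub_one_nonneg m))

end Main

end MultiExit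

end ZoneZ

end PercRepro
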